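import Summits.NavierStokesRegularity.NavierStokesRegularity.Theorems.ScenarioCensusRowA1apTMeter

/-!
# Census rows A1apT / A1trig — part 2/2: meter null (far-past ledger), closures, the wall `Row_A1ap`; census keys

Re-homed for the scenario census (typer seat ns-census-typer-1 g5; lead g7 MINT INTENT addendum ROW A1apT 17:34Z «port keys Row_A1apT / Row_A1trig
+ _excluded (free typer)», CLAIM 17:39Z) from ns-idea-2's LINE «bohr-meter» REV 6 (`pub/ideators/ns-idea-2/lines/bohr-meter/line-bohr-meter.lean`,
sha16 ea3d0b42683d7b31, 917 l., SORRY-FREE; crit 17:31:57Z ✓, ref PRE-CHECK §12.33 ✓, lit §21.12), the almost-periodic block (after `row_A1F_holds`,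
landed as `ScenarioCensusRowA1FModes` / `ScenarioCensusRowA1F`), in two files for the 400-line rule: `ScenarioCensusRowA1apTMeter` (trig slices,
S2 `ModeClosure` (hypothesis), `Row_A1trig`, the meter `upperMeanSq`, `IsBohrAP`, M1/M2/M3 Props, M2 `upperMeanSqLe_holds`, M3
`apVanishOfUpperMeanSqZero_holds` via the tree's `Fourier.IsBohrAlmostPeriodic`, `Row_A1apT`, `row_A1apT_of_stubs`) → `ScenarioCensusRowA1apT`
(`MeterNull` PROVED from the far-past ledger, `row_A1apT_holds`, M3trig `trigVanishOfUpperMeanSqZero_holds`, `row_A1trig_holds`, wall `Row_A1ap`;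
census keys).  Lean text verbatim in namespace `…Theorems.ScenarioCensus.BohrMeter` (`R3` notation spelled out; `stub_*` aliases dropped;
docstrings added where missing).

No census value is asserted here (the lead books A1apT / A1trig); NS regularity is NOT proved; (L′) / A1 stay OPEN; no summit statement is proved.
-/

noncomputable section

set_option linter.unusedVariables false
set_option linter.dupNamespace false
set_option linter.style.longLine false

namespace Summit.NavierStokesRegularity.NavierStokesRegularity.Theorems.ScenarioCensus.BohrMeter

open Set Function Filter Topology MeasureTheory Finset
open scoped BigOperators
open Literature.Analysis Literature.Analysis.FluidPDE
open Summit.NavierStokesRegularity.NavierStokesRegularity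


/-- In the Type-I gauge the meter is nonnegative (ball averages of `|u(t)|²` are `≥ 0` and bounded above). -/
theorem upperMeanSq_nonneg_of_typeI {C : ℝ} {u : ℝ → (EuclideanSpace ℝ (Fin 3)) → (EuclideanSpace ℝ (Fin 3))} (hu : IsTypeIAncientMild C u) {t : ℝ}
    (ht : t < 0) : 0 ≤ upperMeanSq (u t) := by
  have hnt : 0 < -t := neg_pos.2 ht
  have hK : 0 ≤ C ^ 2 / (-t) := div_nonneg (sq_nonneg _) hnt.le
  have hpt : ∀ x, ‖u t x‖ ^ 2 ≤ C ^ 2 / (-t) := by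
    intro x
    have h1 := hu.norm_le ht x
    have hsq : Real.sqrt (-t) ^ 2 = -t := Real.sq_sqrt hnt.le
    calc ‖u t x‖ ^ 2 ≤ (C / Real.sqrt (-t)) ^ 2 := pow_le_pow_left₀ (norm_nonneg _) h1 2
      _ = C ^ 2 / (-t) := by rw [div_pow, hsq]
  have havg : ∀ R : ℝ, ⨍ x in Metric.ball (0 : (EuclideanSpace ℝ (Fin 3))) R, ‖u t x‖ ^ 2 ≤ C ^ 2 / (-t) := fun R =>
    ball_avg_le_of_le hK (fun x => sq_nonneg _) hpt R
  unfold upperMeanSq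
  refine Filter.le_limsup_of_le ⟨C ^ 2 / (-t), Filter.eventually_map.mpr (Filter.Eventually.of_forall havg)⟩
    (fun b hb => ?_)
  obtain ⟨R, hR⟩ := hb.exists
  exact (ball_avg_nonneg (g := fun x => ‖u t x‖ ^ 2) (fun x => sq_nonneg _) R).trans hR

/-- **`MeterNull`** (critic note N1: the structural corollary displayed on its own): every Type-I ancient
KNSS-mild element has ZERO Wiener upper mean square at every time.  The a.p. / trigonometric rows are its
specialisations through M3; the a.p. hypothesis enters only in that last step. -/
def MeterNull : Prop :=
  ∀ (C : ℝ) (u : ℝ → (EuclideanSpace ℝ (Fin 3)) → (EuclideanSpace ℝ (Fin 3))), IsTypeIAncientMild C u → ∀ t < 0, upperMeanSq (u t) = 0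

/-- **PROVED: M1′ ⇒ `MeterNull`** (M2 is a theorem of this file). -/
theorem meterNull_of_M1 (hM1 : UpperMeanSqQuasiAntitone) : MeterNull := by
  intro C u hu t ht
  obtain ⟨K, hK0, hK⟩ := hM1 C u hu
  refine le_antisymm ?_ (upperMeanSq_nonneg_of_typeI hu ht)
  have hbound : ∀ᶠ s in atBot, upperMeanSq (u t) ≤ K * C ^ 2 / (-s) := by
    filter_upwards [eventually_le_atBot t] with s hs
    have hs0 : s < 0 := lt_of_le_of_lt hs ht
    calc upperMeanSq (u t) ≤ K * upperMeanSq (u s) := hK s t hs ht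
      _ ≤ K * (C ^ 2 / (-s)) := mul_le_mul_of_nonneg_left (upperMeanSqLe_holds C u hu s hs0) hK0
      _ = K * C ^ 2 / (-s) := by ring
  have hlim : Tendsto (fun s : ℝ => K * C ^ 2 / (-s)) atBot (𝓝 0) :=
    tendsto_neg_atBot_atTop.const_div_atTop (K * C ^ 2)
  exact ge_of_tendsto hlim hbound

/-- `MeterNull` + M3 ⇒ Row A1apT (the a.p. hypothesis is used only here). -/
theorem row_A1apT_of_meterNull (hN : MeterNull) (hM3 : APVanishOfUpperMeanSqZero) : Row_A1apT := by
  intro C u hu hap t ht x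
  have hzero := hM3 (u t) (hu.continuous_slice ht) (hap t ht) (le_of_eq (hN C u hu t ht))
  simpa using congrFun hzero x

/-- **PROVED (REV 5): `MeterNull` holds OUTRIGHT** — from the tree's FAR-PAST ENERGY LEDGER
`Theorems.FarPastLedger_proof : FarPastLedger` (`∀ C, ∃ K, ∀ u, IsTypeIAncientMild C u → ∀ t < 0, ∀ x₀, ∀ R > 0,
∫_{B_R(x₀)} ‖u t x‖² ≤ K·R`; item stmt-NavierStokesRegularity-14060, CLOSED proved, standard axioms): the ball
average is `≤ K·R / (v₁ R³) → 0`.  So the meter lemma M1′ is no longer an obligation of any row. -/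
theorem meterNull_holds : MeterNull := by
  intro C u hu t ht
  obtain ⟨K, hK⟩ := Theorems.FarPastLedger_proof C
  refine le_antisymm ?_ (upperMeanSq_nonneg_of_typeI hu ht)
  set v₁ : ℝ := volume.real (Metric.ball (0 : (EuclideanSpace ℝ (Fin 3))) 1) with hv₁
  have hv₁pos : 0 < v₁ := by
    rw [hv₁, MeasureTheory.measureReal_def, ENNReal.toReal_pos_iff]
    exact ⟨Metric.measure_ball_pos volume (0 : (EuclideanSpace ℝ (Fin 3))) one_pos, measure_ball_lt_top⟩
  have hvol : ∀ R : ℝ, 0 < R → volume.real (Metric.ball (0 : (EuclideanSpace ℝ (Fin 3))) R) = R ^ 3 * v₁ := by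
    intro R hR
    rw [MeasureTheory.measureReal_def, MeasureTheory.Measure.addHaar_ball_of_pos volume (0 : (EuclideanSpace ℝ (Fin 3))) hR,
      ENNReal.toReal_mul, finrank_euclideanSpace, Fintype.card_fin, ENNReal.toReal_ofReal (by positivity), hv₁,
      MeasureTheory.measureReal_def]
  have havg : ∀ R : ℝ, 0 < R → ⨍ x in Metric.ball (0 : (EuclideanSpace ℝ (Fin 3))) R, ‖u t x‖ ^ 2 ≤ K / (v₁ * R ^ 2) := by
    intro R hR
    rw [MeasureTheory.setAverage_eq, smul_eq_mul, hvol R hR]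
    have hI := hK u hu t ht 0 R hR
    have hpos : 0 < R ^ 3 * v₁ := by positivity
    calc (R ^ 3 * v₁)⁻¹ * ∫ x in Metric.ball (0 : (EuclideanSpace ℝ (Fin 3))) R, ‖u t x‖ ^ 2 ≤ (R ^ 3 * v₁)⁻¹ * (K * R) :=
          mul_le_mul_of_nonneg_left hI (inv_nonneg.2 hpos.le)
      _ = K / (v₁ * R ^ 2) := by field_simp
  have hg : Tendsto (fun R : ℝ => K / (v₁ * R ^ 2)) atTop (𝓝 0) :=
    (Tendsto.const_mul_atTop hv₁pos (tendsto_pow_atTop two_ne_zero)).const_div_atTop K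
  have hev : ∀ᶠ R in atTop, ⨍ x in Metric.ball (0 : (EuclideanSpace ℝ (Fin 3))) R, ‖u t x‖ ^ 2 ≤ K / (v₁ * R ^ 2) := by
    filter_upwards [eventually_gt_atTop 0] with R hR using havg R hR
  unfold upperMeanSq
  calc Filter.limsup (fun R : ℝ => ⨍ x in Metric.ball (0 : (EuclideanSpace ℝ (Fin 3))) R, ‖u t x‖ ^ 2) atTop
      ≤ Filter.limsup (fun R : ℝ => K / (v₁ * R ^ 2)) atTop :=
        Filter.limsup_le_limsup hev
          (Filter.isCoboundedUnder_le_of_le atTop (x := 0) (fun R => ball_avg_nonneg (fun x => sq_nonneg _) R))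
          hg.isBoundedUnder_le
    _ = 0 := hg.limsup_eq

/-- **PROVED (REV 5): Row A1apT hinges on the Bohr lemma M3 ALONE** (MeterNull is a theorem). -/
theorem row_A1apT_of_M3 (hM3 : APVanishOfUpperMeanSqZero) : Row_A1apT :=
  row_A1apT_of_meterNull meterNull_holds hM3

/-- **PROVED (REV 5):** M1′ holds (trivially, both sides vanish by `MeterNull`). -/
theorem upperMeanSqQuasiAntitone_holds : UpperMeanSqQuasiAntitone := by
  intro C u hu
  refine ⟨0, le_rfl, fun s t hst ht => ?_⟩
  rw [meterNull_holds C u hu t ht, zero_mul]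

/-- **PROVED (REV 5):** the sharp M1 holds as well (both sides vanish). -/
theorem upperMeanSqAntitone_holds : UpperMeanSqAntitone := by
  intro C u hu s hs t ht _
  show upperMeanSq (u t) ≤ upperMeanSq (u s)
  rw [meterNull_holds C u hu t ht, meterNull_holds C u hu s hs]

/-- **M3trig `TrigVanishOfUpperMeanSqZero`** (obligation replacing S2 on the trigonometric row; classical harmonic
analysis, no Navier–Stokes content; M-sized in Lean): an `(EuclideanSpace ℝ (Fin 3))`-valued trigonometric polynomial with finitely many
DISTINCT real frequency vectors and ZERO upper mean square vanishes identically — Parseval–Bohr for exponential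
polynomials, `m⁺(Σ a_n e^{in·x}) = Σ |a_n|²` (ball averages of `e^{iξ·x}`, `ξ ≠ 0`, are `O(1/(R|ξ|))`).
Source: Besicovitch, *Almost periodic functions* (1932) ch. I §§2–3; Corduneanu, *Almost periodic functions* Thm 1.12 /
(Parseval) Thm 1.19.  Why it might fail: only by mis-typing (it is a theorem); the `upperMeanSq` junk value is
harmless here because trigonometric polynomials are bounded. -/
def TrigVanishOfUpperMeanSqZero : Prop :=
  ∀ (S : Finset (Fin 3 → ℝ)) (a : (Fin 3 → ℝ) → (Fin 3 → ℂ)) (f : (EuclideanSpace ℝ (Fin 3)) → (EuclideanSpace ℝ (Fin 3))),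
    (∀ x : (EuclideanSpace ℝ (Fin 3)), ∀ i : Fin 3, ((f x i : ℝ) : ℂ) =
      ∑ n ∈ S, a n i * Complex.exp (Complex.I * (∑ j : Fin 3, ((n j : ℝ) : ℂ) * ((x j : ℝ) : ℂ)))) →
    upperMeanSq f ≤ 0 → ∀ x, f x = 0

/-- The bridge «`IsBohrAP` = the tree's `IsBohrAlmostPeriodic`» (definitional). -/
theorem isBohrAP_iff (f : (EuclideanSpace ℝ (Fin 3)) → (EuclideanSpace ℝ (Fin 3))) : IsBohrAP f ↔ Fourier.IsBohrAlmostPeriodic f := Iff.rfl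

/-- The Euclidean norm of a real vector is at most `√3` times the sup norm of its complexification. -/
theorem norm_le_sqrt3_mul (v : (EuclideanSpace ℝ (Fin 3))) (w : Fin 3 → ℂ) (h : ∀ i, ((v i : ℝ) : ℂ) = w i) :
    ‖v‖ ≤ Real.sqrt 3 * ‖w‖ := by
  have hvi : ∀ i, ‖v i‖ ≤ ‖w‖ := by
    intro i
    have e1 : ‖v i‖ = ‖w i‖ := by rw [← h i, Complex.norm_real]
    rw [e1]; exact norm_le_pi_norm w i
  rw [EuclideanSpace.norm_eq]
  have hsum : ∑ i, ‖v i‖ ^ 2 ≤ 3 * ‖w‖ ^ 2 := by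
    calc ∑ i, ‖v i‖ ^ 2 ≤ ∑ i : Fin 3, ‖w‖ ^ 2 :=
          Finset.sum_le_sum fun i _ => pow_le_pow_left₀ (norm_nonneg _) (hvi i) 2
      _ = 3 * ‖w‖ ^ 2 := by simp
  calc Real.sqrt (∑ i, ‖v i‖ ^ 2) ≤ Real.sqrt (3 * ‖w‖ ^ 2) := Real.sqrt_le_sqrt hsum
    _ = Real.sqrt 3 * ‖w‖ := by rw [Real.sqrt_mul (by norm_num), Real.sqrt_sq (norm_nonneg _)]

/-- **M3trig PROVED (REV 6)**: a trigonometric-polynomial field (finitely many real frequency vectors, NO lattice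
condition) is continuous and Bohr almost periodic — tree `Fourier.isBohrAlmostPeriodic_trigPoly` (common translation
vectors of finitely many exponentials by compactness of the torus) transported to the real field through the comparison
lemma `Fourier.IsBohrAlmostPeriodic.of_norm_sub_le` — so M3 applies.  (This replaces the Parseval route announced in REV 5;
no Fourier-coefficient bookkeeping is needed.) -/
theorem trigVanishOfUpperMeanSqZero_holds : TrigVanishOfUpperMeanSqZero := by
  classical
  intro S a f hf hm
  -- the complex vector-valued exponential sum behind `f`
  set g : (EuclideanSpace ℝ (Fin 3)) → (Fin 3 → ℂ) := fun x =>
    ∑ n ∈ S, Complex.exp (Complex.I * ∑ j : Fin 3, ((n j : ℝ) : ℂ) * ((x j : ℝ) : ℂ)) • a n with hg_def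
  have hg : ∀ x i, ((f x i : ℝ) : ℂ) = g x i := by
    intro x i
    rw [hf x i]
    simp only [hg_def, Finset.sum_apply, Pi.smul_apply, smul_eq_mul]
    exact Finset.sum_congr rfl (fun n _ => mul_comm _ _)
  have hg_ap : Fourier.IsBohrAlmostPeriodic g := Fourier.isBohrAlmostPeriodic_trigPoly S a
  have hgc : Continuous g := by
    refine continuous_finsetSum S (fun n _ => ?_)
    have hphase : Continuous (fun x : (EuclideanSpace ℝ (Fin 3)) =>
        Complex.exp (Complex.I * ∑ j : Fin 3, ((n j : ℝ) : ℂ) * ((x j : ℝ) : ℂ))) := by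
      refine Complex.continuous_exp.comp (continuous_const.mul ?_)
      refine continuous_finsetSum _ (fun j _ => continuous_const.mul ?_)
      exact Complex.continuous_ofReal.comp (PiLp.continuous_apply 2 _ j)
    exact hphase.smul continuous_const
  -- continuity of `f`, componentwise from `g`
  have hfi : ∀ i, Continuous (fun x => f x i) := by
    intro i
    have e : (fun x => f x i) = fun x => (g x i).re := by
      funext x; rw [← hg x i, Complex.ofReal_re]
    rw [e]
    exact Complex.continuous_re.comp ((continuous_apply i).comp hgc)
  have hfc : Continuous f := by
    have e : f = fun x => WithLp.toLp 2 (fun i => f x i) := by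
      funext x; rfl
    rw [e]
    exact (PiLp.continuous_toLp 2 _).comp (continuous_pi hfi)
  -- almost periodicity of `f` by comparison with `g`
  have hcomp : ∀ x τ, ‖f (x + τ) - f x‖ ≤ Real.sqrt 3 * ‖g (x + τ) - g x‖ := by
    intro x τ
    refine norm_le_sqrt3_mul _ _ (fun i => ?_)
    rw [PiLp.sub_apply, Complex.ofReal_sub, hg, hg, Pi.sub_apply]
  have hf_ap : IsBohrAP f := (isBohrAP_iff f).2 (hg_ap.of_norm_sub_le hcomp)
  have h0 : f = 0 := apVanishOfUpperMeanSqZero_holds f hfc hf_ap hm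
  intro x
  rw [h0]; rfl


/-- **Row A1apT EXCLUDED (REV 6, sorry-free)**: a KNSS-gauge Type-I ancient mild solution with Bohr-almost-periodic
slices is identically zero. -/
theorem row_A1apT_holds : Row_A1apT := row_A1apT_of_M3 apVanishOfUpperMeanSqZero_holds

/-- **PROVED (REV 5): Row A1trig hinges on M3trig ALONE** (alternative to the S2 `ModeClosure` path):
`MeterNull` (a theorem) + Parseval–Bohr. -/
theorem row_A1trig_of_M3trig (h : TrigVanishOfUpperMeanSqZero) : Row_A1trig := by
  intro C u S c hu _ _ _ _ htrig t ht x
  exact h S (fun n => c n t) (u t) (fun y i => htrig t ht y i) (le_of_eq (meterNull_holds C u hu t ht)) x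

/-- **Row A1trig EXCLUDED (REV 6, sorry-free)**: a KNSS-gauge Type-I ancient mild solution whose slices are
trigonometric polynomials with finitely many (possibly incommensurate) real frequencies is identically zero. -/
theorem row_A1trig_holds : Row_A1trig := row_A1trig_of_M3trig trigVanishOfUpperMeanSqZero_holds

/-- Bridge BY NAME (census lattice): the A-block hard core (L′) contains the almost-periodic cell. -/
theorem row_A1apT_of_typeIAncientLiouville (h : Theses.SymmetryModuliCount.TypeIAncientLiouville) :
    Row_A1apT :=
  fun C u hu _ => h C u (isTypeIAncientMild_iff.1 hu)

/-! ## 4. The wall: the almost-periodic cell in the BOUNDED class (small divisors) -/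

/-- **Row A1ap** (proposed census row; OPEN — the wall of this line): a bounded ancient mild solution
(duality class of census A1) with Bohr-almost-periodic slices has constant slices.  Without the Type-I rate
the meter is only non-increasing; for an infinite frequency module the spectral gap closes (small divisors).
Not attacked here; recorded with its bridge from A1. -/
def Row_A1ap : Prop :=
  ∀ u : ℝ → (EuclideanSpace ℝ (Fin 3)) → (EuclideanSpace ℝ (Fin 3)), FluidPDE.IsBoundedAncientMildSolution 1 u →
    (∀ t < 0, AEStronglyMeasurable (u t) volume) → (∀ t < 0, IsBohrAP (u t)) →
      ∀ t < 0, ∃ b : (EuclideanSpace ℝ (Fin 3)), u t =ᵐ[volume] fun _ => b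

/-- Bridge BY NAME: census A1 (`LiouvilleConjectureNS`, KNSS bounded ancient Liouville) contains the wall. -/
theorem row_A1ap_of_liouvilleConjectureNS (h : Literature.Analysis.FluidPDE.LiouvilleConjectureNS) :
    Row_A1ap :=
  fun u hu hmeas _ => h u hu hmeas


end Summit.NavierStokesRegularity.NavierStokesRegularity.Theorems.ScenarioCensus.BohrMeter

namespace Summit.NavierStokesRegularity.NavierStokesRegularity.Theorems.ScenarioCensus

/-- Census row A1apT — (Type I in time, KNSS gauge `IsTypeIAncientMild C u` · ancient · no symmetry; instead Bohr-ALMOST-PERIODIC slices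
(`BohrMeter.IsBohrAP (u t)` for every `t < 0`)): `u ≡ 0`, BY NAME `BohrMeter.Row_A1apT` (ns-idea-2 LINE «bohr-meter» REV 6, VERBATIM).
Closed by `row_A1apT_excluded`; the census lead books the value. -/
def Row_A1apT : Prop := BohrMeter.Row_A1apT

/-- A1apT is PROVED in the tree: `BohrMeter.row_A1apT_holds` (meter null from the far-past ledger + M3: a continuous Bohr-a.p. field with
zero upper mean square vanishes, tree `Fourier.IsBohrAlmostPeriodic`).  No summit proved. -/
theorem row_A1apT_excluded : Row_A1apT := BohrMeter.row_A1apT_holds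

/-- Census in-row sibling A1trig — (same class · slices = trigonometric polynomials with a finite real frequency set): `u ≡ 0`, BY NAME
`BohrMeter.Row_A1trig` (VERBATIM).  Closed by `row_A1trig_excluded`. -/
def Row_A1trig : Prop := BohrMeter.Row_A1trig

/-- A1trig is PROVED in the tree: `BohrMeter.row_A1trig_holds`. -/
theorem row_A1trig_excluded : Row_A1trig := BohrMeter.row_A1trig_holds

end Summit.NavierStokesRegularity.NavierStokesRegularity.Theorems.ScenarioCensus

end
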